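import Mathlib
import Literature.Computability.AlgebraicComplexity.FixedPointLog
import Summits.RiemannHypothesis.RiemannHypothesis.Theorems.WeilFormatCJointShiftSOS
import Summits.RiemannHypothesis.RiemannHypothesis.Theorems.WeilFormatCJointShiftCert
import HarnessLib

/-!
# Joint-phantom shift certificate: real semantics and the certified brackets

Helper file (`--supports stmt-RiemannHypothesis-0098`), RH-free; seat rh-explicit-weil-1.  Companion of
`WeilFormatCJointShiftCert.lean` (the kernel checker): the real meaning of the data (`Cert.phi` = the frequency
`γ·ℓ`, `Cert.wt` = the weight `log p_j/√(p_j^e)`, `Cert.val` = the value of a class table against the shift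
correlations `I_f`), the unpacking of the structural checks, and the BRACKET lemmas: the claimed logarithm
enclosures are the tree's certified ones (`log_bracket`), admissibility is certified (`two_mul_lt_abs_phi_of_adm`:
`adm γ → 2a < |γ·ℓ|` for every `a ≤ aQ`), and the weight brackets (`wt_bracket`).  Standard axioms only.
-/

set_option linter.dupNamespace false



noncomputable section

namespace Summit.RiemannHypothesis.RiemannHypothesis.Theorems.WeilFormatC

namespace JointSOS

open MeasureTheory Set Finset
open scoped Real BigOperators
open Literature.Computability.AlgebraicComplexity

/-- `canon d` is `d` or `−d`. -/
theorem canon_eq_or (d : ZVec4) : canon d = d ∨ canon d = vneg d := by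
  unfold canon; split_ifs <;> simp

namespace Cert

variable (c : Cert)

/-! ### Real semantics of the data -/

/-- The real frequency `γ·ℓ`, `ℓ_j = log p_j`. [folklore] -/
def phi (γ : ZVec4) : ℝ :=
  (γ.1 : ℝ) * Real.log (c.pj 0) + (γ.2.1 : ℝ) * Real.log (c.pj 1) +
    (γ.2.2.1 : ℝ) * Real.log (c.pj 2) + (γ.2.2.2 : ℝ) * Real.log (c.pj 3)

/-- The weight `log p_j / √(p_j^e)` of the window item `(j, e, s)`. [folklore] -/
def wt (w : WItem) : ℝ := Real.log (c.pj w.1) / Real.sqrt ((c.pj w.1 : ℝ) ^ w.2.1)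

/-- Sum of the weights of a list of window items. [folklore] -/
def wsum : List WItem → ℝ
  | [] => 0
  | w :: ws => c.wt w + wsum ws

/-- The value of a class table against the shift correlations of `f`:
`Σ_{(γ, v, ws)} (v/4^k + 2 Σ_{ws} wt) · I_f(γ·ℓ)`. [folklore] -/
def val (f : ℝ → ℝ) : List Entry → ℝ
  | [] => 0
  | (γ, v, ws) :: rest =>
      ((v : ℝ) / (4 : ℝ) ^ c.kbits + 2 * c.wsum ws) * (∫ x, f (x - c.phi γ) * f x) + val f rest

/-- `phi_vneg` (see the module docstring). [folklore] -/
theorem phi_vneg (γ : ZVec4) : c.phi (vneg γ) = -c.phi γ := by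
  simp only [phi, vneg]; push_cast; ring

/-- `phi_zero` (see the module docstring). [folklore] -/
theorem phi_zero : c.phi (0, 0, 0, 0) = 0 := by simp [phi]

/-- For `j < 4`, `φ(e·unit j) = e · log p_j`. -/
theorem phi_uvec {j : ℕ} (hj : j < 4) (e : ℤ) : c.phi (uvec j e) = (e : ℝ) * Real.log (c.pj j) := by
  interval_cases j <;> simp [phi, uvec, pj]

/-- `phi_vsub_swap` (see the module docstring). [folklore] -/
theorem phi_vsub_swap (u v : ZVec4) : c.phi (vsub u v) = -c.phi (vsub v u) := by
  simp only [phi, vsub]; push_cast; ring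

/-- The correlation at the canonical class equals the correlation at the class. -/
theorem corr_canon (f : ℝ → ℝ) (d : ZVec4) :
    (∫ x, f (x - c.phi (canon d)) * f x) = ∫ x, f (x - c.phi d) * f x := by
  rcases canon_eq_or d with h | h
  · rw [h]
  · rw [h, phi_vneg]; exact shiftCorr_neg f _

variable {c}

/-! ### The logarithm and weight brackets -/

section Brackets

/-- Range hint of prime `j` (any `j`; indices `≥ 3` read slot 3). -/
theorem hint_j (hh : c.hintsOK = true) (j : ℕ) : 2 ^ c.ej j ≤ c.pj j ∧ c.pj j ≤ 2 ^ (c.ej j + 1) := by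
  simp only [hintsOK, Bool.and_eq_true, FixedPoint.inRange_iff] at hh
  by_cases h0 : j = 0
  · subst h0; exact hh.1.1.1
  by_cases h1 : j = 1
  · subst h1; exact hh.1.1.2
  by_cases h2 : j = 2
  · subst h2; exact hh.1.2
  have e3 : c.ej j = c.ej 3 := by simp [ej, h0, h1, h2]
  have p3 : c.pj j = c.pj 3 := by simp [pj, h0, h1, h2]
  rw [e3, p3]; exact hh.2

/-- `one_le_pj` (see the module docstring). [folklore] -/
theorem one_le_pj (hh : c.hintsOK = true) (j : ℕ) : 1 ≤ c.pj j :=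
  le_trans (Nat.one_le_two_pow) (hint_j hh j).1

/-- `logLo j ≤ 2^P log p_j ≤ logHi j`. -/
theorem log_bracket (hh : c.hintsOK = true) (hl : c.logsOK = true) (j : ℕ) :
    (c.logLo j : ℝ) ≤ (2 : ℝ) ^ c.prec * Real.log (c.pj j) ∧
      (2 : ℝ) ^ c.prec * Real.log (c.pj j) ≤ (c.logHi j : ℝ) := by
  have hint := hint_j hh j
  simp only [logsOK, Bool.and_eq_true, decide_eq_true_eq] at hl
  obtain ⟨⟨⟨hlo, hhi⟩, _⟩, _⟩ := hl
  have hLo : c.logLo j = FixedPoint.logNatLo c.prec c.terms (c.ej j) (c.pj j) := by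
    by_cases h0 : j = 0
    · subst h0; simp [logLo, ej, pj, hlo]
    by_cases h1 : j = 1
    · subst h1; simp [logLo, ej, pj, hlo]
    by_cases h2 : j = 2
    · subst h2; simp [logLo, ej, pj, hlo]
    simp [logLo, ej, pj, hlo, h0, h1, h2]
  have hHi : c.logHi j = FixedPoint.logNatHi c.prec c.terms (c.ej j) (c.pj j) := by
    by_cases h0 : j = 0
    · subst h0; simp [logHi, ej, pj, hhi]
    by_cases h1 : j = 1
    · subst h1; simp [logHi, ej, pj, hhi]
    by_cases h2 : j = 2
    · subst h2; simp [logHi, ej, pj, hhi]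
    simp [logHi, ej, pj, hhi, h0, h1, h2]
  rw [hLo, hHi]
  exact ⟨FixedPoint.logNatLo_sound _ _ hint.1 hint.2, FixedPoint.logNatHi_sound _ _ hint.1 hint.2⟩

/-- `mulLogLo j x ≤ 2^P · x log p_j ≤ mulLogHi j x`. -/
theorem mulLog_bracket (hh : c.hintsOK = true) (hl : c.logsOK = true) (j : ℕ) (x : ℤ) :
    (c.mulLogLo j x : ℝ) ≤ (2 : ℝ) ^ c.prec * ((x : ℝ) * Real.log (c.pj j)) ∧
      (2 : ℝ) ^ c.prec * ((x : ℝ) * Real.log (c.pj j)) ≤ (c.mulLogHi j x : ℝ) := by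
  obtain ⟨hlo, hhi⟩ := log_bracket hh hl j
  unfold mulLogLo mulLogHi
  by_cases hx : 0 ≤ x
  · rw [if_pos hx, if_pos hx]; push_cast
    have hx' : (0 : ℝ) ≤ x := by exact_mod_cast hx
    constructor <;> nlinarith
  · rw [if_neg hx, if_neg hx]; push_cast
    have hx' : (x : ℝ) ≤ 0 := by exact_mod_cast (le_of_lt (not_le.1 hx))
    constructor <;> nlinarith

/-- `freqLo γ ≤ 2^P · γ·ℓ ≤ freqHi γ`. -/
theorem freq_bracket (hh : c.hintsOK = true) (hl : c.logsOK = true) (γ : ZVec4) :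
    (c.freqLo γ : ℝ) ≤ (2 : ℝ) ^ c.prec * c.phi γ ∧ (2 : ℝ) ^ c.prec * c.phi γ ≤ (c.freqHi γ : ℝ) := by
  have h0 := mulLog_bracket hh hl 0 γ.1
  have h1 := mulLog_bracket hh hl 1 γ.2.1
  have h2 := mulLog_bracket hh hl 2 γ.2.2.1
  have h3 := mulLog_bracket hh hl 3 γ.2.2.2
  unfold freqLo freqHi phi
  push_cast
  constructor <;> nlinarith [h0.1, h0.2, h1.1, h1.2, h2.1, h2.2, h3.1, h3.2]

/-- **Admissibility is certified**: `adm γ → 2a < |γ·ℓ|` for every `a ≤ aQ`. -/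
theorem two_mul_lt_abs_phi_of_adm (hh : c.hintsOK = true) (hl : c.logsOK = true) (hden : 0 < c.aden)
    {γ : ZVec4} (hγ : c.adm γ = true) {a : ℝ} (ha : a ≤ c.aQ) : 2 * a < |c.phi γ| := by
  obtain ⟨hlo, hhi⟩ := freq_bracket hh hl γ
  simp only [logsOK, Bool.and_eq_true, decide_eq_true_eq] at hl
  obtain ⟨⟨_, hthr⟩, hden'⟩ := hl
  have hP : (0 : ℝ) < (2 : ℝ) ^ c.prec := by positivity
  have hdenR : (0 : ℝ) < (c.aden : ℝ) := by exact_mod_cast hden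
  have haQ : (2 : ℝ) ^ (c.prec + 1) * (c.aQ : ℝ) * (c.aden : ℝ) = (c.thr : ℝ) := by
    have hd : ((c.aQ.den : ℕ) : ℝ) ≠ 0 := by exact_mod_cast c.aQ.den_ne_zero
    rw [hthr, hden']
    push_cast
    rw [mul_assoc, Rat.cast_def, div_mul_cancel₀ _ hd]
  simp only [adm, Bool.or_eq_true, decide_eq_true_eq] at hγ
  have ha' : (2 : ℝ) ^ c.prec * (2 * a) ≤ (2 : ℝ) ^ (c.prec + 1) * (c.aQ : ℝ) := by
    rw [pow_succ]; have : (a : ℝ) ≤ (c.aQ : ℝ) := by exact_mod_cast ha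
    nlinarith
  rcases hγ with h | h
  · have h' : (c.thr : ℝ) < (c.freqLo γ : ℝ) * (c.aden : ℝ) := by exact_mod_cast h
    have : (2 : ℝ) ^ c.prec * (2 * a) < (2 : ℝ) ^ c.prec * c.phi γ := by
      have h2 : (2 : ℝ) ^ (c.prec + 1) * (c.aQ : ℝ) < (c.freqLo γ : ℝ) := by
        by_contra hcon
        push Not at hcon
        have := mul_le_mul_of_nonneg_right hcon hdenR.le
        linarith
      linarith
    have : 2 * a < c.phi γ := lt_of_mul_lt_mul_left this hP.le
    exact lt_of_lt_of_le this (le_abs_self _)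
  · have h' : (c.freqHi γ : ℝ) * (c.aden : ℝ) < -(c.thr : ℝ) := by exact_mod_cast h
    have : (2 : ℝ) ^ c.prec * c.phi γ < -((2 : ℝ) ^ c.prec * (2 * a)) := by
      have h2 : (c.freqHi γ : ℝ) < -((2 : ℝ) ^ (c.prec + 1) * (c.aQ : ℝ)) := by
        by_contra hcon
        push Not at hcon
        have := mul_le_mul_of_nonneg_right hcon hdenR.le
        linarith
      linarith
    have : c.phi γ < -(2 * a) := by nlinarith
    have : 2 * a < -c.phi γ := by linarith
    exact lt_of_lt_of_le this (neg_le_abs _)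

/-- **Weight brackets**: `wLo w ≤ log p_j/√(p_j^e) ≤ wHi w` for a well-formed window item. -/
theorem wt_bracket (hh : c.hintsOK = true) (hl : c.logsOK = true) (w : WItem) (hw : c.witemOK w = true) :
    (c.wLo w : ℝ) ≤ c.wt w ∧ c.wt w ≤ (c.wHi w : ℝ) := by
  obtain ⟨_, _, hs, hs1, hs2⟩ := witemOK_spec hw
  obtain ⟨hlo, hhi⟩ := log_bracket hh hl w.1
  have hp : 1 ≤ c.pj w.1 := one_le_pj hh w.1
  have hP : (0 : ℝ) < (2 : ℝ) ^ c.prec := by positivity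
  set s : ℕ := w.2.2 with hsdef
  have h4 : (4 : ℝ) ^ c.prec = ((2 : ℝ) ^ c.prec) ^ 2 := by
    rw [← pow_mul, mul_comm, pow_mul]; norm_num
  have hcast : (((c.pj w.1 ^ w.2.1 * 4 ^ c.prec : ℕ) : ℝ)) = ((c.pj w.1 : ℝ) ^ w.2.1) * ((2 : ℝ) ^ c.prec) ^ 2 := by
    push_cast; rw [h4]
  have hsq : Real.sqrt ((c.pj w.1 : ℝ) ^ w.2.1) * (2 : ℝ) ^ c.prec =
      Real.sqrt (((c.pj w.1 ^ w.2.1 * 4 ^ c.prec : ℕ) : ℝ)) := by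
    rw [hcast, Real.sqrt_mul' _ (by positivity), Real.sqrt_sq hP.le]
  have hSlo : (s : ℝ) ≤ Real.sqrt (((c.pj w.1 ^ w.2.1 * 4 ^ c.prec : ℕ) : ℝ)) := by
    refine Real.le_sqrt_of_sq_le ?_
    exact_mod_cast hs1
  have hShi : Real.sqrt (((c.pj w.1 ^ w.2.1 * 4 ^ c.prec : ℕ) : ℝ)) ≤ (s : ℝ) + 1 := by
    refine Real.sqrt_le_iff.2 ⟨by positivity, ?_⟩
    exact_mod_cast hs2.le
  have hsR : (0 : ℝ) < (s : ℝ) := by exact_mod_cast hs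
  have hroot : 0 < Real.sqrt ((c.pj w.1 : ℝ) ^ w.2.1) := by
    apply Real.sqrt_pos.2; have : (1 : ℝ) ≤ c.pj w.1 := by exact_mod_cast hp
    positivity
  unfold wLo wHi wt
  push_cast
  constructor
  · rw [div_le_div_iff₀ (by positivity) hroot]
    have h1 : (c.logLo w.1 : ℝ) * Real.sqrt ((c.pj w.1 : ℝ) ^ w.2.1) * (2 : ℝ) ^ c.prec ≤
        Real.log (c.pj w.1) * ((s : ℝ) + 1) * (2 : ℝ) ^ c.prec := by
      calc (c.logLo w.1 : ℝ) * Real.sqrt ((c.pj w.1 : ℝ) ^ w.2.1) * (2 : ℝ) ^ c.prec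
          = (c.logLo w.1 : ℝ) * Real.sqrt (((c.pj w.1 ^ w.2.1 * 4 ^ c.prec : ℕ) : ℝ)) := by rw [mul_assoc, hsq]
        _ ≤ ((2 : ℝ) ^ c.prec * Real.log (c.pj w.1)) * ((s : ℝ) + 1) :=
            mul_le_mul hlo hShi (Real.sqrt_nonneg _) (by positivity)
        _ = Real.log (c.pj w.1) * ((s : ℝ) + 1) * (2 : ℝ) ^ c.prec := by ring
    exact le_of_mul_le_mul_right h1 hP
  · rw [div_le_div_iff₀ hroot hsR]
    have h1 : Real.log (c.pj w.1) * (s : ℝ) * (2 : ℝ) ^ c.prec ≤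
        (c.logHi w.1 : ℝ) * Real.sqrt ((c.pj w.1 : ℝ) ^ w.2.1) * (2 : ℝ) ^ c.prec := by
      calc Real.log (c.pj w.1) * (s : ℝ) * (2 : ℝ) ^ c.prec
          = ((2 : ℝ) ^ c.prec * Real.log (c.pj w.1)) * (s : ℝ) := by ring
        _ ≤ (c.logHi w.1 : ℝ) * Real.sqrt (((c.pj w.1 ^ w.2.1 * 4 ^ c.prec : ℕ) : ℝ)) :=
            mul_le_mul hhi hSlo hsR.le (le_trans (by positivity) hhi)
        _ = (c.logHi w.1 : ℝ) * Real.sqrt ((c.pj w.1 : ℝ) ^ w.2.1) * (2 : ℝ) ^ c.prec := by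
            rw [mul_assoc, hsq]
    exact le_of_mul_le_mul_right h1 hP

/-- Brackets of weight sums. -/
theorem wsum_bracket (hh : c.hintsOK = true) (hl : c.logsOK = true) {ws : List WItem}
    (hws : ∀ w ∈ ws, c.witemOK w = true) :
    (c.wLoSum ws : ℝ) ≤ c.wsum ws ∧ c.wsum ws ≤ (c.wHiSum ws : ℝ) := by
  induction ws with
  | nil => simp [wLoSum, wHiSum, wsum]
  | cons w rest ih =>
      have hw := wt_bracket hh hl w (hws w (by simp))
      have ih' := ih fun w' hw' ↦ hws w' (List.mem_cons_of_mem _ hw')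
      simp only [wLoSum, wHiSum, wsum]; push_cast
      exact ⟨add_le_add hw.1 ih'.1, add_le_add hw.2 ih'.2⟩

end Brackets

/-! ### The full pair term and its positivity (from the torus-SOS transfer file) -/

section FullTerm

variable (c) (f : ℝ → ℝ)

/-- The full (both orientations) pair term. -/
def fullTerm (sa sc : ZVec4 × List ℤ) : ℝ :=
  (dotZ sa.2 sc.2 : ℝ) / (4 : ℝ) ^ c.kbits * ∫ x, f (x - c.phi (vsub sc.1 sa.1)) * f x


/-- `dotZ_comm` (see the module docstring). [folklore] -/
theorem dotZ_comm : ∀ (l₁ l₂ : List ℤ), dotZ l₁ l₂ = dotZ l₂ l₁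
  | [], [] => rfl
  | [], _ :: _ => rfl
  | _ :: _, [] => rfl
  | a :: as, b :: bs => by rw [dotZ, dotZ, dotZ_comm as bs, mul_comm]

/-- `fullTerm_symm` (see the module docstring). [folklore] -/
theorem fullTerm_symm (sa sc : ZVec4 × List ℤ) : c.fullTerm f sa sc = c.fullTerm f sc sa := by
  unfold fullTerm
  rw [dotZ_comm, phi_vsub_swap, shiftCorr_neg f]


end FullTerm

section Positivity

variable (c) {f : ℝ → ℝ} {C a : ℝ}

/-- `dotZ` on lists of length `r` is the `Fin r` sum of products of `getD` entries. -/
theorem dotZ_eq_sum : ∀ (r : ℕ) (l₁ l₂ : List ℤ), l₁.length = r → l₂.length = r →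
    (dotZ l₁ l₂ : ℝ) = ∑ i : Fin r, ((l₁.getD i 0 : ℤ) : ℝ) * ((l₂.getD i 0 : ℤ) : ℝ)
  | 0, [], [], _, _ => by simp [dotZ]
  | r + 1, a :: as, b :: bs, h₁, h₂ => by
      simp only [List.length_cons, Nat.add_right_cancel_iff] at h₁ h₂
      rw [dotZ, Fin.sum_univ_succ]
      simp only [List.getD_cons_zero, Fin.val_zero, Fin.val_succ, List.getD_cons_succ]
      push_cast
      rw [dotZ_eq_sum r as bs h₁ h₂]
  | 0, _ :: _, _, h, _ => by simp at h
  | 0, [], _ :: _, _, h => by simp at h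
  | _ + 1, [], _, h, _ => by simp at h
  | _ + 1, _ :: _, [], _, h => by simp at h

/-- The exponent vector of a `ZVec4` as a function on `Fin 4`. -/
def toF (v : ZVec4) : Fin 4 → ℤ := ![v.1, v.2.1, v.2.2.1, v.2.2.2]

/-- `phi_eq_sum` (see the module docstring). [folklore] -/
theorem phi_eq_sum (γ : ZVec4) :
    c.phi γ = ∑ j : Fin 4, ((toF γ j : ℤ) : ℝ) * Real.log (c.pj j) := by
  rw [Fin.sum_univ_four]
  simp only [toF, Matrix.cons_val_zero, Matrix.cons_val_one, Matrix.cons_val_two,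
    Matrix.cons_val_three, phi, Fin.val_zero, Fin.val_one, Fin.val_two]
  norm_num [pj]

/-- `toF_vsub` (see the module docstring). [folklore] -/
theorem toF_vsub (u v : ZVec4) : toF (vsub u v) = toF u - toF v := by
  ext j
  fin_cases j <;> simp [toF, vsub]

/-- A list sum is a `Fin` sum over positions. -/
theorem list_sum_map_eq_sum_fin {σ : Type*} (L : List σ) (g : σ → ℝ) :
    (L.map g).sum = ∑ α : Fin L.length, g L[(α : ℕ)] := by
  rw [← List.ofFn_getElem_eq_map L g, List.sum_ofFn]

/-- A list double sum is a `Fin` double sum. -/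
theorem list_double_sum {σ : Type*} (L : List σ) (F : σ → σ → ℝ) :
    (L.map fun a ↦ (L.map fun b ↦ F a b).sum).sum =
      ∑ α : Fin L.length, ∑ β : Fin L.length, F L[(α : ℕ)] L[(β : ℕ)] := by
  rw [list_sum_map_eq_sum_fin]
  exact Finset.sum_congr rfl fun α _ ↦ list_sum_map_eq_sum_fin _ _

/-- **Positivity of the full pair sum**: for the Gram data of the certificate (all Gram vectors of length
`rank`), `0 ≤ Σ_α Σ_β (⟨c_α, c_β⟩/4^k) · I_f((S_β − S_α)·ℓ)`. -/
theorem pairSum_nonneg (hcols : colsOK c.rank c.mc = true) (hf : Measurable f) (hC : ∀ x, |f x| ≤ C)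
    (hsupp : ∀ x, x ∉ Icc (-a) a → f x = 0) :
    0 ≤ (c.mc.map fun sa ↦ (c.mc.map fun sc ↦ c.fullTerm f sa sc).sum).sum := by
  have hlen := colsOK_spec hcols
  let ℓ : Fin 4 → ℝ := fun j ↦ Real.log (c.pj j)
  let S : Fin c.mc.length → Fin 4 → ℤ := fun α ↦ toF (c.mc[(α : ℕ)]).1
  let R : Fin c.rank → Fin c.mc.length → ℝ :=
    fun i α ↦ (((c.mc[(α : ℕ)]).2.getD i 0 : ℤ) : ℝ) / (2 : ℝ) ^ c.kbits
  have hpos := shiftCorr_gram_nonneg ℓ S R hf hC hsupp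
  rw [list_double_sum]
  have heq : (∑ α : Fin c.mc.length, ∑ β : Fin c.mc.length, c.fullTerm f (c.mc[(α : ℕ)]) (c.mc[(β : ℕ)])) =
      ∑ α : Fin c.mc.length, ∑ β : Fin c.mc.length, (∑ i, R i α * R i β) *
        ∫ x, f (x - ∑ j, (((S β - S α) j : ℤ) : ℝ) * ℓ j) * f x := by
    refine Finset.sum_congr rfl fun α _ ↦ Finset.sum_congr rfl fun β _ ↦ ?_
    have hα : (c.mc[(α : ℕ)]).2.length = c.rank := hlen _ (List.getElem_mem _)
    have hβ : (c.mc[(β : ℕ)]).2.length = c.rank := hlen _ (List.getElem_mem _)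
    have hdot : (dotZ (c.mc[(α : ℕ)]).2 (c.mc[(β : ℕ)]).2 : ℝ) / (4 : ℝ) ^ c.kbits =
        ∑ i : Fin c.rank, R i α * R i β := by
      rw [dotZ_eq_sum c.rank _ _ hα hβ, Finset.sum_div]
      refine Finset.sum_congr rfl fun i _ ↦ ?_
      simp only [R]
      rw [show ((4 : ℝ)) ^ c.kbits = (2 : ℝ) ^ c.kbits * (2 : ℝ) ^ c.kbits by rw [← mul_pow]; norm_num]
      field_simp
    have hphi : c.phi (vsub (c.mc[(β : ℕ)]).1 (c.mc[(α : ℕ)]).1) = ∑ j, (((S β - S α) j : ℤ) : ℝ) * ℓ j := by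
      rw [phi_eq_sum, show S β - S α = toF (vsub (c.mc[(β : ℕ)]).1 (c.mc[(α : ℕ)]).1) by
        simp only [S, toF_vsub]]
    unfold fullTerm
    rw [hdot, hphi]
  rw [heq]; exact hpos

end Positivity



end Cert

end JointSOS

end Summit.RiemannHypothesis.RiemannHypothesis.Theorems.WeilFormatC
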